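import Mathlib

/-!
# Tier7/Line3/SchurProjector — Schur orthogonality: the integrated one-vector coefficient is the rank-one projector
(seat t7-L1-p4)

LINE 3 (t7-plan-3), version (ii), memo v12 §2g property (2): at the COMPACT place `ι₁` the line's test function is
the one-vector coefficient `f(g) = d_τ · ⟪τ g u, u⟫` of the finite-dimensional irreducible unitary `τ` of the compact
group `U(W_A)(F_{ι₁})`, and «by Schur orthogonality `R(f)` is the orthogonal projection onto the `u`-line in each copy
of `τ` and kills every `σ ≇ τ`». THIS FILE proves that statement in the abstract, for a compact group `G` with a
left-invariant probability measure `μ` and continuous finite-dimensional unitary representations on complex inner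
product spaces (Mathlib only):

* Schur's lemma (pure algebra; `IsIrreducible` = `V ≠ 0` and no stable submodule but `⊥`, `⊤`): an intertwiner
  between non-isomorphic irreducibles is `0` (`eq_zero_of_intertwines`); an intertwiner of an irreducible with itself
  is a scalar (`exists_eq_smul_id`, via `Module.End.exists_eigenvalue` over `ℂ`);
* the averaging operator `avg μ σ τ B = ∫ σ g ∘ B ∘ τ g⁻¹ dμ` intertwines (`intertwines_avg`; left invariance only);
  its trace is the trace of `B` when `σ = τ` (`trace_avg`);
* **Schur orthogonality**: `∫ ⟪τ g a, x⟫ • σ g b dμ = 0` for non-isomorphic irreducibles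
  (`integral_inner_smul_apply_eq_zero`) and `∫ ⟪τ g a, x⟫ • τ g b dμ = (⟪a, b⟫ / d) • x` for `τ` irreducible of
  dimension `d` (`integral_inner_smul_apply`); the inner-product form
  `∫ conj ⟪τ g a, x⟫ · ⟪τ g b, y⟫ dμ = conj (⟪a, b⟫ / d) · ⟪x, y⟫` (`integral_inner_mul_inner`);
* **the projector** `integral_inner_smul_apply_self`: `d • ∫ ⟪τ g u, u⟫ • τ g v dμ = ⟪u, v⟫ • u` — the integrated
  form of `f = d · ⟪τ g u, u⟫` is `v ↦ ⟪u, v⟫ • u`, for `‖u‖ = 1` the orthogonal projection onto the line `ℂ u`, and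
  it is `0` on every `σ ≇ τ`.

(Conventions: Mathlib's inner product is conjugate-linear in the FIRST slot, so `⟪τ g u, u⟫` here is the classical
`conj ⟨τ(g)u, u⟩` in the physicists' convention — the memo's `f_v`.) Nothing here is about an adelic group, a period
or (N); the identification of `U(W_A)(F_{ι₁})` with a compact group acting on the `τ`-space is the dictionary (in
words). No sorry; axioms ⊆ {propext, Classical.choice, Quot.sound}.
-/

namespace Summit.Ventures.HodgeRepro2.Tier7.Line3.SchurProjector

open MeasureTheory
open scoped InnerProductSpace

section Schur

variable {G : Type*} [Group G]
variable {V : Type*} [NormedAddCommGroup V] [InnerProductSpace ℂ V]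
variable {W : Type*} [NormedAddCommGroup W] [InnerProductSpace ℂ W]

/-- a submodule stable under every `τ g`. -/
def IsStable (τ : G →* (V →L[ℂ] V)) (U : Submodule ℂ V) : Prop := ∀ g, ∀ v ∈ U, τ g v ∈ U

/-- irreducible: `V ≠ 0` and the only stable submodules are `⊥` and `⊤`. -/
structure IsIrreducible (τ : G →* (V →L[ℂ] V)) : Prop where
  nontrivial : Nontrivial V
  eq_bot_or_eq_top : ∀ U : Submodule ℂ V, IsStable τ U → U = ⊥ ∨ U = ⊤

/-- `A` intertwines `τ` and `σ`: `σ g ∘ A = A ∘ τ g`. -/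
def Intertwines (σ : G →* (W →L[ℂ] W)) (τ : G →* (V →L[ℂ] V)) (A : V →L[ℂ] W) : Prop :=
  ∀ g, σ g ∘L A = A ∘L τ g

/-- the pointwise form of intertwining. -/
theorem Intertwines.apply {σ : G →* (W →L[ℂ] W)} {τ : G →* (V →L[ℂ] V)} {A : V →L[ℂ] W}
    (hA : Intertwines σ τ A) (g : G) (v : V) : σ g (A v) = A (τ g v) := by
  have h := congrArg (fun T : V →L[ℂ] W => T v) (hA g)
  simpa only [ContinuousLinearMap.comp_apply] using h

/-- the kernel of an intertwiner is stable. -/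
theorem isStable_ker {σ : G →* (W →L[ℂ] W)} {τ : G →* (V →L[ℂ] V)} {A : V →L[ℂ] W}
    (hA : Intertwines σ τ A) : IsStable τ (LinearMap.ker (A : V →ₗ[ℂ] W)) := by
  intro g v hv
  rw [LinearMap.mem_ker] at hv ⊢
  simp only [ContinuousLinearMap.coe_coe] at hv ⊢
  rw [← hA.apply g v, hv, map_zero]

/-- the range of an intertwiner is stable. -/
theorem isStable_range {σ : G →* (W →L[ℂ] W)} {τ : G →* (V →L[ℂ] V)} {A : V →L[ℂ] W}
    (hA : Intertwines σ τ A) : IsStable σ (LinearMap.range (A : V →ₗ[ℂ] W)) := by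
  intro g w hw
  rw [LinearMap.mem_range] at hw ⊢
  obtain ⟨v, rfl⟩ := hw
  exact ⟨τ g v, (hA.apply g v).symm⟩

/-- two representations are isomorphic: an equivariant linear equivalence. -/
def IsEquivIso (σ : G →* (W →L[ℂ] W)) (τ : G →* (V →L[ℂ] V)) : Prop :=
  ∃ e : V ≃ₗ[ℂ] W, ∀ g v, e (τ g v) = σ g (e v)

/-- **Schur's lemma I**: an intertwiner between non-isomorphic irreducible representations is zero. -/
theorem eq_zero_of_intertwines {σ : G →* (W →L[ℂ] W)} {τ : G →* (V →L[ℂ] V)} {A : V →L[ℂ] W}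
    (hσ : IsIrreducible σ) (hτ : IsIrreducible τ) (hA : Intertwines σ τ A) (hne : ¬ IsEquivIso σ τ) :
    A = 0 := by
  by_contra h0
  -- the kernel is `⊥`
  have hker : LinearMap.ker (A : V →ₗ[ℂ] W) = ⊥ := by
    rcases hτ.eq_bot_or_eq_top _ (isStable_ker hA) with h | h
    · exact h
    · exfalso
      apply h0
      ext v
      have hv : v ∈ LinearMap.ker (A : V →ₗ[ℂ] W) := h ▸ Submodule.mem_top
      rw [LinearMap.mem_ker] at hv
      simpa only [ContinuousLinearMap.coe_coe, zero_apply] using hv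
  -- the range is `⊤`
  have hrange : LinearMap.range (A : V →ₗ[ℂ] W) = ⊤ := by
    rcases hσ.eq_bot_or_eq_top _ (isStable_range hA) with h | h
    · exfalso
      apply h0
      ext v
      have hv : (A : V →ₗ[ℂ] W) v ∈ LinearMap.range (A : V →ₗ[ℂ] W) := LinearMap.mem_range_self _ v
      rw [h, Submodule.mem_bot] at hv
      simpa only [ContinuousLinearMap.coe_coe, zero_apply] using hv
    · exact h
  apply hne
  refine ⟨LinearEquiv.ofBijective (A : V →ₗ[ℂ] W)
    ⟨LinearMap.ker_eq_bot.1 hker, LinearMap.range_eq_top.1 hrange⟩, fun g v => ?_⟩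
  simp only [LinearEquiv.ofBijective_apply, ContinuousLinearMap.coe_coe]
  exact (hA.apply g v).symm

/-- **Schur's lemma II**: an intertwiner of an irreducible representation with itself is a scalar. -/
theorem exists_eq_smul_id [FiniteDimensional ℂ V] {τ : G →* (V →L[ℂ] V)} {A : V →L[ℂ] V}
    (hτ : IsIrreducible τ) (hA : Intertwines τ τ A) : ∃ c : ℂ, A = c • ContinuousLinearMap.id ℂ V := by
  haveI := hτ.nontrivial
  obtain ⟨c, hc⟩ := Module.End.exists_eigenvalue (A : V →ₗ[ℂ] V)
  refine ⟨c, ?_⟩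
  -- `A - c • id` intertwines, so its kernel is stable and non-zero, hence everything
  have hA' : Intertwines τ τ (A - c • ContinuousLinearMap.id ℂ V) := by
    intro g
    ext v
    simp only [ContinuousLinearMap.comp_apply, sub_apply, smul_apply,
      ContinuousLinearMap.id_apply, map_sub, map_smul]
    rw [hA.apply g v]
  set A' : V →L[ℂ] V := A - c • ContinuousLinearMap.id ℂ V with hA'def
  have hker : LinearMap.ker (A' : V →ₗ[ℂ] V) = ⊤ := by
    rcases hτ.eq_bot_or_eq_top _ (isStable_ker hA') with h | h
    · exfalso
      obtain ⟨v, hv⟩ := hc.exists_hasEigenvector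
      have hv0 : v ≠ 0 := hv.2
      have hmem : v ∈ LinearMap.ker (A' : V →ₗ[ℂ] V) := by
        rw [LinearMap.mem_ker]
        have hav : A v = c • v := by
          have := hv.apply_eq_smul
          simpa only [ContinuousLinearMap.coe_coe] using this
        simp only [hA'def, ContinuousLinearMap.coe_coe, sub_apply,
          smul_apply, ContinuousLinearMap.id_apply, hav, sub_self]
      rw [h, Submodule.mem_bot] at hmem
      exact hv0 hmem
    · exact h
  have hzero : A' = 0 := by
    ext v
    have hmem : v ∈ LinearMap.ker (A' : V →ₗ[ℂ] V) := hker ▸ Submodule.mem_top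
    rw [LinearMap.mem_ker] at hmem
    simpa only [ContinuousLinearMap.coe_coe, zero_apply] using hmem
  exact sub_eq_zero.1 hzero

end Schur

section Averaging

variable {G : Type*} [Group G]
variable {V : Type*} [NormedAddCommGroup V] [InnerProductSpace ℂ V]
variable {W : Type*} [NormedAddCommGroup W] [InnerProductSpace ℂ W]

/-- `τ (a * b) v = τ a (τ b v)`. -/
theorem apply_mul_apply (τ : G →* (V →L[ℂ] V)) (a b : G) (v : V) : τ (a * b) v = τ a (τ b v) := by
  rw [map_mul, ContinuousLinearMap.mul_def, ContinuousLinearMap.comp_apply]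

/-- `τ g⁻¹ (τ g v) = v`. -/
theorem apply_inv_apply (τ : G →* (V →L[ℂ] V)) (g : G) (v : V) : τ g⁻¹ (τ g v) = v := by
  rw [← apply_mul_apply, inv_mul_cancel, map_one, one_apply_eq_self]

/-- `τ g (τ g⁻¹ v) = v`. -/
theorem apply_apply_inv (τ : G →* (V →L[ℂ] V)) (g : G) (v : V) : τ g (τ g⁻¹ v) = v := by
  rw [← apply_mul_apply, mul_inv_cancel, map_one, one_apply_eq_self]

/-- the averaged operator `∫ σ g ∘ B ∘ τ g⁻¹ dμ(g)`. -/
noncomputable def avg [MeasurableSpace G] (μ : Measure G) (σ : G →* (W →L[ℂ] W))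
    (τ : G →* (V →L[ℂ] V)) (B : V →L[ℂ] W) : V →L[ℂ] W :=
  ∫ g, σ g ∘L B ∘L τ g⁻¹ ∂μ

/-- the integrand is continuous for continuous `σ`, `τ`. -/
theorem continuous_integrand [TopologicalSpace G] [IsTopologicalGroup G] (σ : G →* (W →L[ℂ] W))
    (τ : G →* (V →L[ℂ] V)) (hσ : Continuous σ) (hτ : Continuous τ) (B : V →L[ℂ] W) :
    Continuous fun g => σ g ∘L B ∘L τ g⁻¹ :=
  hσ.clm_comp (continuous_const.clm_comp (hτ.comp continuous_inv))

/-- the integrand is integrable (compact `G`, finite `μ`). -/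
theorem integrable_integrand [TopologicalSpace G] [IsTopologicalGroup G] [CompactSpace G] [MeasurableSpace G]
    [BorelSpace G] (μ : Measure G) [IsFiniteMeasure μ] (σ : G →* (W →L[ℂ] W)) (τ : G →* (V →L[ℂ] V))
    (hσ : Continuous σ) (hτ : Continuous τ) (B : V →L[ℂ] W) :
    Integrable (fun g => σ g ∘L B ∘L τ g⁻¹) μ :=
  (continuous_integrand σ τ hσ hτ B).integrable_of_hasCompactSupport (HasCompactSupport.of_compactSpace _)

/-- **the average intertwines** (left invariance of `μ`). -/
theorem intertwines_avg [TopologicalSpace G] [IsTopologicalGroup G] [CompactSpace G] [MeasurableSpace G]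
    [BorelSpace G] (μ : Measure G) [IsFiniteMeasure μ] [μ.IsMulLeftInvariant] [CompleteSpace W]
    (σ : G →* (W →L[ℂ] W)) (τ : G →* (V →L[ℂ] V)) (hσ : Continuous σ) (hτ : Continuous τ) (B : V →L[ℂ] W) :
    Intertwines σ τ (avg μ σ τ B) := by
  intro h
  have hint := integrable_integrand μ σ τ hσ hτ B
  -- post-composition with `σ h` and pre-composition with `τ h` are continuous linear maps on the operator space
  have e1 : σ h ∘L avg μ σ τ B = ∫ g, σ h ∘L (σ g ∘L B ∘L τ g⁻¹) ∂μ := by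
    unfold avg
    have := (ContinuousLinearMap.compL ℂ V W W (σ h)).integral_comp_comm hint
    simp only [ContinuousLinearMap.compL_apply] at this
    exact this.symm
  have e2 : avg μ σ τ B ∘L τ h = ∫ g, (σ g ∘L B ∘L τ g⁻¹) ∘L τ h ∂μ := by
    unfold avg
    have := ((ContinuousLinearMap.compL ℂ V V W).flip (τ h)).integral_comp_comm hint
    simp only [ContinuousLinearMap.flip_apply, ContinuousLinearMap.compL_apply] at this
    exact this.symm
  rw [e1, e2]
  -- the integrands agree after the substitution `g ↦ h * g`
  have e3 : ∀ g, σ h ∘L (σ g ∘L B ∘L τ g⁻¹) = (σ (h * g) ∘L B ∘L τ (h * g)⁻¹) ∘L τ h := by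
    intro g
    ext v
    simp only [ContinuousLinearMap.comp_apply]
    rw [← apply_mul_apply τ (h * g)⁻¹ h v, mul_inv_rev, inv_mul_cancel_right, apply_mul_apply σ h g]
  simp_rw [e3]
  exact integral_mul_left_eq_self (fun g => (σ g ∘L B ∘L τ g⁻¹) ∘L τ h) h

/-- the trace, as a continuous linear functional on the (finite-dimensional) operator space. -/
noncomputable def traceCLM [FiniteDimensional ℂ V] : (V →L[ℂ] V) →L[ℂ] ℂ :=
  LinearMap.toContinuousLinearMap ((LinearMap.trace ℂ V).comp (ContinuousLinearMap.coeLM ℂ))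

/-- `traceCLM A = trace A`. -/
theorem traceCLM_apply [FiniteDimensional ℂ V] (A : V →L[ℂ] V) :
    traceCLM A = LinearMap.trace ℂ V (A : V →ₗ[ℂ] V) := rfl

/-- `trace (τ g ∘ B ∘ τ g⁻¹) = trace B`. -/
theorem trace_conj_apply [FiniteDimensional ℂ V] (τ : G →* (V →L[ℂ] V)) (B : V →L[ℂ] V) (g : G) :
    LinearMap.trace ℂ V ((τ g ∘L B ∘L τ g⁻¹ : V →L[ℂ] V) : V →ₗ[ℂ] V) =
      LinearMap.trace ℂ V (B : V →ₗ[ℂ] V) := by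
  have e : ((τ g ∘L B ∘L τ g⁻¹ : V →L[ℂ] V) : V →ₗ[ℂ] V) =
      (τ g : V →ₗ[ℂ] V) * ((B : V →ₗ[ℂ] V) * (τ g⁻¹ : V →ₗ[ℂ] V)) := by
    ext v
    simp only [ContinuousLinearMap.coe_coe, ContinuousLinearMap.comp_apply, Module.End.mul_apply]
  have h1 : (τ g⁻¹ : V →ₗ[ℂ] V) * (τ g : V →ₗ[ℂ] V) = 1 := by
    ext v
    simp only [Module.End.mul_apply, ContinuousLinearMap.coe_coe, Module.End.one_apply, apply_inv_apply]
  rw [e, LinearMap.trace_mul_comm, mul_assoc, h1, mul_one]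

/-- **the trace of the average is the trace of `B`** (`σ = τ`). -/
theorem trace_avg [TopologicalSpace G] [IsTopologicalGroup G] [CompactSpace G] [MeasurableSpace G]
    [BorelSpace G] (μ : Measure G) [IsProbabilityMeasure μ] [FiniteDimensional ℂ V] [CompleteSpace V]
    (τ : G →* (V →L[ℂ] V)) (hτ : Continuous τ) (B : V →L[ℂ] V) :
    LinearMap.trace ℂ V ((avg μ τ τ B : V →L[ℂ] V) : V →ₗ[ℂ] V) = LinearMap.trace ℂ V (B : V →ₗ[ℂ] V) := by
  have hint := integrable_integrand μ τ τ hτ hτ B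
  have h1 : traceCLM (avg μ τ τ B) = ∫ g, traceCLM (τ g ∘L B ∘L τ g⁻¹) ∂μ := by
    unfold avg
    exact (traceCLM.integral_comp_comm hint).symm
  rw [← traceCLM_apply, h1]
  simp_rw [traceCLM_apply, trace_conj_apply]
  simp

end Averaging

section Orthogonality

variable {G : Type*} [Group G]
variable {V : Type*} [NormedAddCommGroup V] [InnerProductSpace ℂ V]
variable {W : Type*} [NormedAddCommGroup W] [InnerProductSpace ℂ W]

/-- a unitary representation: every `τ g` preserves the inner product. -/
def IsUnitaryRep (τ : G →* (V →L[ℂ] V)) : Prop := ∀ g x y, ⟪τ g x, τ g y⟫_ℂ = ⟪x, y⟫_ℂ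

/-- `⟪a, τ g⁻¹ x⟫ = ⟪τ g a, x⟫` for a unitary representation. -/
theorem inner_apply_inv (τ : G →* (V →L[ℂ] V)) (hτ : IsUnitaryRep τ) (g : G) (a x : V) :
    ⟪a, τ g⁻¹ x⟫_ℂ = ⟪τ g a, x⟫_ℂ := by
  conv_rhs => rw [← apply_apply_inv τ g x]
  exact (hτ g a (τ g⁻¹ x)).symm

/-- the rank-one operator `x ↦ ⟪a, x⟫ • b`. -/
noncomputable def rankOne (a : V) (b : W) : V →L[ℂ] W := (innerSL ℂ a).smulRight b

/-- `rankOne a b x = ⟪a, x⟫ • b`. -/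
theorem rankOne_apply (a : V) (b : W) (x : V) : rankOne a b x = ⟪a, x⟫_ℂ • b := rfl

/-- the trace of `rankOne a b` is `⟪a, b⟫`. -/
theorem trace_rankOne [FiniteDimensional ℂ V] (a b : V) :
    LinearMap.trace ℂ V ((rankOne a b : V →L[ℂ] V) : V →ₗ[ℂ] V) = ⟪a, b⟫_ℂ := by
  have e : ((rankOne a b : V →L[ℂ] V) : V →ₗ[ℂ] V) =
      ((innerSL ℂ a : V →L[ℂ] ℂ) : V →ₗ[ℂ] ℂ).smulRight b := rfl
  rw [e, LinearMap.trace_smulRight]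
  rfl

/-- the average of a rank-one operator, applied to `x`: `∫ ⟪τ g a, x⟫ • σ g b dμ`. -/
theorem avg_rankOne_apply [TopologicalSpace G] [IsTopologicalGroup G] [CompactSpace G] [MeasurableSpace G]
    [BorelSpace G] (μ : Measure G) [IsFiniteMeasure μ] (σ : G →* (W →L[ℂ] W)) (τ : G →* (V →L[ℂ] V))
    (hσ : Continuous σ) (hτ : Continuous τ) (hτu : IsUnitaryRep τ) (a : V) (b : W) (x : V) :
    avg μ σ τ (rankOne a b) x = ∫ g, ⟪τ g a, x⟫_ℂ • σ g b ∂μ := by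
  unfold avg
  rw [ContinuousLinearMap.integral_apply (integrable_integrand μ σ τ hσ hτ _)]
  refine integral_congr_ae (Filter.Eventually.of_forall fun g => ?_)
  simp only [ContinuousLinearMap.comp_apply, rankOne_apply, map_smul, inner_apply_inv τ hτu]

/-- **Schur orthogonality, non-isomorphic case**: `∫ ⟪τ g a, x⟫ • σ g b dμ = 0`. -/
theorem integral_inner_smul_apply_eq_zero [TopologicalSpace G] [IsTopologicalGroup G] [CompactSpace G]
    [MeasurableSpace G] [BorelSpace G] (μ : Measure G) [IsFiniteMeasure μ] [μ.IsMulLeftInvariant]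
    [CompleteSpace W] (σ : G →* (W →L[ℂ] W)) (τ : G →* (V →L[ℂ] V)) (hσ : Continuous σ) (hτ : Continuous τ)
    (hτu : IsUnitaryRep τ) (hσi : IsIrreducible σ) (hτi : IsIrreducible τ) (hne : ¬ IsEquivIso σ τ)
    (a : V) (b : W) (x : V) : ∫ g, ⟪τ g a, x⟫_ℂ • σ g b ∂μ = 0 := by
  rw [← avg_rankOne_apply μ σ τ hσ hτ hτu, eq_zero_of_intertwines hσi hτi (intertwines_avg μ σ τ hσ hτ _) hne]
  rfl

/-- **Schur orthogonality, the scalar**: `avg (rankOne a b) = (⟪a, b⟫ / d) • id` for irreducible `τ`. -/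
theorem avg_rankOne_eq [TopologicalSpace G] [IsTopologicalGroup G] [CompactSpace G] [MeasurableSpace G]
    [BorelSpace G] (μ : Measure G) [IsProbabilityMeasure μ] [μ.IsMulLeftInvariant] [FiniteDimensional ℂ V]
    [CompleteSpace V] (τ : G →* (V →L[ℂ] V)) (hτ : Continuous τ) (hτi : IsIrreducible τ) (a b : V) :
    avg μ τ τ (rankOne a b) = ((Module.finrank ℂ V : ℂ)⁻¹ * ⟪a, b⟫_ℂ) • ContinuousLinearMap.id ℂ V := by
  obtain ⟨c, hc⟩ := exists_eq_smul_id hτi (intertwines_avg μ τ τ hτ hτ (rankOne a b))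
  have htr := trace_avg μ τ hτ (rankOne a b)
  rw [hc, trace_rankOne] at htr
  -- `trace (c • id) = c * d`
  have hd : LinearMap.trace ℂ V ((c • ContinuousLinearMap.id ℂ V : V →L[ℂ] V) : V →ₗ[ℂ] V) =
      c * Module.finrank ℂ V := by
    rw [ContinuousLinearMap.toLinearMap_smul, ContinuousLinearMap.coe_id, LinearMap.map_smul, LinearMap.trace_id,
      smul_eq_mul]
  rw [hd] at htr
  haveI := hτi.nontrivial
  have hd0 : (Module.finrank ℂ V : ℂ) ≠ 0 := by
    exact_mod_cast (Module.finrank_pos (R := ℂ) (M := V)).ne'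
  rw [hc]
  congr 1
  rw [← htr, mul_comm c, inv_mul_cancel_left₀ hd0]

/-- **Schur orthogonality, irreducible case, the projector formula**:
`∫ ⟪τ g a, x⟫ • τ g b dμ = (⟪a, b⟫ / d) • x`. -/
theorem integral_inner_smul_apply [TopologicalSpace G] [IsTopologicalGroup G] [CompactSpace G]
    [MeasurableSpace G] [BorelSpace G] (μ : Measure G) [IsProbabilityMeasure μ] [μ.IsMulLeftInvariant]
    [FiniteDimensional ℂ V] [CompleteSpace V] (τ : G →* (V →L[ℂ] V)) (hτ : Continuous τ)
    (hτu : IsUnitaryRep τ) (hτi : IsIrreducible τ) (a b x : V) :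
    ∫ g, ⟪τ g a, x⟫_ℂ • τ g b ∂μ = ((Module.finrank ℂ V : ℂ)⁻¹ * ⟪a, b⟫_ℂ) • x := by
  rw [← avg_rankOne_apply μ τ τ hτ hτ hτu, avg_rankOne_eq μ τ hτ hτi]
  rfl

/-- **the integrated one-vector coefficient is the rank-one projector**:
`d • ∫ ⟪τ g u, u⟫ • τ g v dμ = ⟪u, v⟫ • u` for every `u` — for `‖u‖ = 1` the orthogonal projection of `v` onto the
line `ℂ u`. -/
theorem integral_inner_smul_apply_self [TopologicalSpace G] [IsTopologicalGroup G] [CompactSpace G]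
    [MeasurableSpace G] [BorelSpace G] (μ : Measure G) [IsProbabilityMeasure μ] [μ.IsMulLeftInvariant]
    [FiniteDimensional ℂ V] [CompleteSpace V] (τ : G →* (V →L[ℂ] V)) (hτ : Continuous τ)
    (hτu : IsUnitaryRep τ) (hτi : IsIrreducible τ) (u v : V) :
    (Module.finrank ℂ V : ℂ) • ∫ g, ⟪τ g u, u⟫_ℂ • τ g v ∂μ = ⟪u, v⟫_ℂ • u := by
  rw [integral_inner_smul_apply μ τ hτ hτu hτi, smul_smul]
  haveI := hτi.nontrivial
  have hd0 : (Module.finrank ℂ V : ℂ) ≠ 0 := by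
    exact_mod_cast (Module.finrank_pos (R := ℂ) (M := V)).ne'
  rw [mul_inv_cancel_left₀ hd0]

/-- **Schur orthogonality relation** (inner-product form): for irreducible unitary `τ` of dimension `d`,
`∫ conj ⟪τ g a, x⟫ · ⟪τ g b, y⟫ dμ = conj (⟪a, b⟫ / d) · ⟪x, y⟫`. -/
theorem integral_inner_mul_inner [TopologicalSpace G] [IsTopologicalGroup G] [CompactSpace G]
    [MeasurableSpace G] [BorelSpace G] (μ : Measure G) [IsProbabilityMeasure μ] [μ.IsMulLeftInvariant]
    [FiniteDimensional ℂ V] [CompleteSpace V] (τ : G →* (V →L[ℂ] V)) (hτ : Continuous τ)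
    (hτu : IsUnitaryRep τ) (hτi : IsIrreducible τ) (a b x y : V) :
    ∫ g, (starRingEnd ℂ) ⟪τ g a, x⟫_ℂ * ⟪τ g b, y⟫_ℂ ∂μ =
      (starRingEnd ℂ) ((Module.finrank ℂ V : ℂ)⁻¹ * ⟪a, b⟫_ℂ) * ⟪x, y⟫_ℂ := by
  have h := integral_inner_smul_apply μ τ hτ hτu hτi a b x
  have hint : Integrable (fun g => ⟪τ g a, x⟫_ℂ • τ g b) μ := by
    refine Continuous.integrable_of_hasCompactSupport ?_ (HasCompactSupport.of_compactSpace _)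
    refine Continuous.smul ?_ (hτ.clm_apply continuous_const)
    exact continuous_inner.comp ((hτ.clm_apply continuous_const).prodMk continuous_const)
  have e1 : ∫ g, (starRingEnd ℂ) ⟪τ g a, x⟫_ℂ * ⟪τ g b, y⟫_ℂ ∂μ =
      ⟪∫ g, ⟪τ g a, x⟫_ℂ • τ g b ∂μ, y⟫_ℂ := by
    rw [← inner_conj_symm, ← integral_inner hint, ← integral_conj]
    refine integral_congr_ae (Filter.Eventually.of_forall fun g => ?_)
    simp only [inner_smul_right, map_mul, inner_conj_symm]
  rw [e1, h, inner_smul_left]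

end Orthogonality

end Summit.Ventures.HodgeRepro2.Tier7.Line3.SchurProjector
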